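import Summits.Ventures.WeilGRH.DualTrigKernelSoundA
import HarnessLib

/-!
# Format D-K soundness, part 4: coefficients, interval Horner, inner minimum, remainders

Cell `rh-explicit`, WEIL TRACK — GRH ARM, route B (weil-grh-3).  Continuation of
`DualTrigKernelSoundA.lean`:

* `coeffs_mem` — `coeffs` encloses the Taylor coefficients `s_m · moment_m / m!`;
* `hornerZ_mem`, `poly_ge_innerLo` — interval Horner on the integer sub-cells bounds a polynomial with
  enclosed coefficients from below on `|φ| ≤ η⁺` by `innerLo / S`;
* `remSum_le_remBlock` — the Taylor remainder of a represented list is at most `remBlock.hi / S`.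

Everything here is PROVED; no named facts, no `sorry`.
-/

noncomputable section

open Finset Real

namespace Summit.Ventures.WeilGRH

open Literature.Analysis.ValidatedNumerics.NumericsMP
open DualTrigTaylor

namespace DKCert

variable {c : DKCert}

/-! ### Coefficients -/

/-- `s_m = (−1)^{⌊m/2⌋}` is `1` or `−1` according to `(m/2) % 2`. [folklore] -/
theorem sgn_eq (m : ℕ) : RTerm.sgn m = if (m / 2) % 2 = 0 then 1 else -1 := by
  unfold RTerm.sgn
  split_ifs with h
  · exact Even.neg_one_pow (Nat.even_iff.2 h)
  · exact Odd.neg_one_pow (Nat.odd_iff.2 (by omega))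

/-- `coeffs` encloses the Taylor coefficients of the represented list. [folklore] -/
theorem coeffs_mem {rts : List RTerm} {θc : ℝ} {mom : List MI} (h : MomMem c rts θc mom) :
    ∀ m < 2 * c.R, MI.mem c.S (coefSum rts θc m) ((c.coeffs mom).getD m dft) := by
  intro m hm
  have hfac : 0 < m.factorial := Nat.factorial_pos m
  have hx : MI.mem c.S (moment rts θc m / (m.factorial : ℕ)) ((mom.getD m dft).divNat m.factorial) :=
    MI.mem_divNat (h m hm) hfac
  simp only [coeffs, List.getD_eq_getElem?_getD, List.getElem?_map, List.getElem?_range hm, Option.map_some,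
    Option.getD_some, coefSum, sgn_eq]
  rw [List.getD_eq_getElem?_getD] at hx
  split_ifs with hs
  · simpa using hx
  · have := MI.mem_neg hx
    convert this using 1
    ring

/-- The length of `coeffs`. [folklore] -/
theorem coeffs_length (mom : List MI) : (c.coeffs mom).length = 2 * c.R := by simp [coeffs]

/-! ### Polynomials with enclosed coefficients -/

/-- `Σ_{m<n} cr(m) φ^m`. [folklore] -/
def polyR (cr : ℕ → ℝ) (n : ℕ) (φ : ℝ) : ℝ := ∑ m ∈ range n, cr m * φ ^ m

/-- Coefficientwise enclosure of a real coefficient sequence by a list. [folklore] -/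
def CoefMem (c : DKCert) (cr : ℕ → ℝ) (cs : List MI) : Prop := ∀ m < cs.length, MI.mem c.S (cr m) (cs.getD m dft)

/-- `scaleCoeffs` encloses the coefficients of the polynomial in `ψ = (nin/η⁺) φ`. [folklore] -/
theorem scaleCoeffs_mem {b : DKBlock} (hden : 1 ≤ b.etaDen) (hnin : 1 ≤ b.nin) {cr : ℕ → ℝ} {cs : List MI}
    (h : CoefMem c cr cs) :
    CoefMem c (fun m ↦ cr m * ((b.etaNum : ℝ) / (b.nin * b.etaDen)) ^ m) (scaleCoeffs b cs) ∧
      (scaleCoeffs b cs).length = cs.length := by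
  refine ⟨fun m hm ↦ ?_, by simp [scaleCoeffs]⟩
  simp only [scaleCoeffs, List.length_map, List.length_range] at hm
  simp only [scaleCoeffs, List.getD_eq_getElem?_getD, List.getElem?_map, List.getElem?_range hm,
    Option.map_some, Option.getD_some]
  have h1 := MI.mem_mulInt (h m hm) ((b.etaNum : ℤ) ^ m)
  have h2 := MI.mem_divNat h1 (n := (b.nin * b.etaDen) ^ m) (by positivity)
  rw [List.getD_eq_getElem?_getD] at h2
  convert h2 using 1
  push_cast
  rw [div_pow]
  ring

/-- `mulUnitRange I a` encloses `x ψ` for `x ∈ I`, `ψ ∈ [a, a+1]`. [folklore] -/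
theorem mem_mulUnitRange {x ψ : ℝ} {I : MI} (hx : MI.mem c.S x I) {a : ℤ} (h1 : (a : ℝ) ≤ ψ) (h2 : ψ ≤ a + 1) :
    MI.mem c.S (x * ψ) (mulUnitRange I a) := by
  unfold mulUnitRange
  have ha := MI.mem_mulInt hx a
  have hb := MI.mem_mulInt hx (a + 1)
  push_cast at hb
  refine mem_hull_of_between ha hb ?_
  rcases le_total 0 x with hx0 | hx0
  · left; constructor <;> nlinarith
  · right; constructor <;> nlinarith

/-- **Interval Horner**: `hornerZ cs a` encloses `Σ_{m < |cs|} cr(m) ψ^m` for `ψ ∈ [a, a+1]`. [folklore] -/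
theorem hornerZ_mem {ψ : ℝ} {a : ℤ} (h1 : (a : ℝ) ≤ ψ) (h2 : ψ ≤ a + 1) :
    ∀ (cs : List MI) (cr : ℕ → ℝ), CoefMem c cr cs → MI.mem c.S (polyR cr cs.length ψ) (c.hornerZ cs a)
  | [], cr, _ => by simpa [polyR, hornerZ] using MI.mem_ofInt c.S 0
  | cm :: rest, cr, h => by
      have hrest : CoefMem c (fun m ↦ cr (m + 1)) rest := fun m hm ↦ by
        have := h (m + 1) (by simpa using hm)
        simpa using this
      have ih := hornerZ_mem h1 h2 rest (fun m ↦ cr (m + 1)) hrest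
      have h0 : MI.mem c.S (cr 0) cm := by simpa using h 0 (by simp)
      have e : polyR cr (cm :: rest).length ψ = polyR (fun m ↦ cr (m + 1)) rest.length ψ * ψ + cr 0 := by
        simp only [polyR, List.length_cons, Finset.sum_range_succ', pow_zero, mul_one, pow_succ]
        rw [Finset.sum_mul]
        congr 1
        exact Finset.sum_congr rfl fun m _ ↦ by ring
      rw [e]
      show MI.mem c.S _ ((cm :: rest).foldr (fun cm acc ↦ (mulUnitRange acc a).add cm) (MI.ofInt c.S 0))
      rw [List.foldr_cons]
      exact MI.mem_add (mem_mulUnitRange ih h1 h2) h0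

/-- `List.foldr min init l` is `≤ init` and `≤` every element. [folklore] -/
theorem foldr_min_le (l : List ℤ) (init : ℤ) :
    l.foldr min init ≤ init ∧ ∀ y ∈ l, l.foldr min init ≤ y := by
  induction l with
  | nil => simp
  | cons x l ih =>
      simp only [List.foldr_cons, List.mem_cons, forall_eq_or_imp]
      exact ⟨(min_le_right _ _).trans ih.1, min_le_left _ _, fun y hy ↦ (min_le_right _ _).trans (ih.2 y hy)⟩

/-- **The inner minimum bounds the polynomial on the whole cell**: for `|φ| ≤ η⁺ = etaNum/etaDen`,
`Σ_{m<|cs|} cr(m) φ^m ≥ innerLo b cs / S`. [folklore] -/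
theorem poly_ge_innerLo (hS : 0 < c.S) {b : DKBlock} (hden : 1 ≤ b.etaDen) (hnin : 1 ≤ b.nin)
    (hnum : 1 ≤ b.etaNum) {cr : ℕ → ℝ} {cs : List MI} (h : CoefMem c cr cs) {φ : ℝ}
    (hφ : |φ| ≤ (b.etaNum : ℝ) / b.etaDen) :
    ((c.innerLo b cs : ℤ) : ℝ) / c.S ≤ polyR cr cs.length φ := by
  obtain ⟨hsc, hlen⟩ := scaleCoeffs_mem hden hnin h
  set u : ℝ := (b.etaNum : ℝ) / (b.nin * b.etaDen) with hu
  have hu0 : 0 < u := by rw [hu]; positivity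
  set ψ : ℝ := φ / u with hψ
  have hφu : φ = u * ψ := by rw [hψ]; field_simp
  -- range of ψ
  have hψr : |ψ| ≤ b.nin := by
    rw [hψ, abs_div, abs_of_pos hu0, div_le_iff₀ hu0, hu]
    calc |φ| ≤ (b.etaNum : ℝ) / b.etaDen := hφ
      _ = (b.nin : ℝ) * ((b.etaNum : ℝ) / (b.nin * b.etaDen)) := by field_simp
  rw [abs_le] at hψr
  -- the polynomial in ψ
  have hpoly : polyR cr cs.length φ = polyR (fun m ↦ cr m * u ^ m) (scaleCoeffs b cs).length ψ := by
    rw [hlen]; simp only [polyR, hφu, mul_pow]; exact Finset.sum_congr rfl fun m _ ↦ by ring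
  rw [hpoly]
  -- the sub-cell containing ψ
  set a : ℤ := min ⌊ψ⌋ ((b.nin : ℤ) - 1) with ha
  have ha1 : (a : ℝ) ≤ ψ := by
    have : (a : ℝ) ≤ ⌊ψ⌋ := by exact_mod_cast min_le_left _ _
    exact this.trans (Int.floor_le ψ)
  have ha2 : ψ ≤ a + 1 := by
    rcases le_total ⌊ψ⌋ ((b.nin : ℤ) - 1) with hle | hle
    · rw [ha, min_eq_left hle]; exact (Int.lt_floor_add_one ψ).le
    · rw [ha, min_eq_right hle]; push_cast; linarith
  have halo : -(b.nin : ℤ) ≤ a := by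
    have hf : -(b.nin : ℤ) ≤ ⌊ψ⌋ := by
      rw [Int.le_floor]; push_cast; linarith
    rw [ha]; exact le_min hf (by omega)
  have hahi : a ≤ (b.nin : ℤ) - 1 := min_le_right _ _
  have hmem := hornerZ_mem ha1 ha2 (scaleCoeffs b cs) _ hsc
  -- innerLo ≤ that Horner lower end
  set i : ℕ := (a + b.nin).toNat with hi
  have hi2 : i < 2 * b.nin := by omega
  have hia : (i : ℤ) - b.nin = a := by omega
  have hle : c.innerLo b cs ≤ (c.hornerZ (scaleCoeffs b cs) a).lo := by
    unfold innerLo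
    have hy : (c.hornerZ (scaleCoeffs b cs) a).lo ∈
        (List.range (2 * b.nin)).map fun (i : ℕ) ↦ (c.hornerZ (scaleCoeffs b cs) ((i : ℤ) - b.nin)).lo :=
      List.mem_map.2 ⟨i, List.mem_range.2 hi2, by rw [hia]⟩
    exact (foldr_min_le _ _).2 _ hy
  have hSr : (0 : ℝ) < c.S := by exact_mod_cast hS
  calc ((c.innerLo b cs : ℤ) : ℝ) / c.S ≤ ((c.hornerZ (scaleCoeffs b cs) a).lo : ℝ) / c.S :=
        div_le_div_of_nonneg_right (by exact_mod_cast hle) hSr.le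
    _ ≤ _ := lo_le hS hmem

/-! ### The Taylor remainder of a block -/

/-- One term: `rem ≤ x` for a member `x` of `remTerm`. [folklore] -/
theorem rem_le_remTerm (hS : 0 < c.S) {t : GTerm} {rt : RTerm} (h : GRepr c.S c.R t rt) {η : ℝ} (hη : 0 ≤ η)
    {etaPow : List MI} (hep : ∀ m ≤ 2 * c.R + 1, MI.mem c.S (η ^ m) (etaPow.getD m dft)) :
    ∃ x : ℝ, rt.rem η c.R ≤ x ∧ MI.mem c.S x (c.remTerm etaPow t) := by
  have hSr : (0 : ℝ) < c.S := by exact_mod_cast hS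
  -- the dominating real numbers
  set a' : ℝ := (t.A.absHi : ℝ) / c.S + (t.B.absHi : ℝ) / c.S
  set k1 : ℝ := ((t.kpow.getD (2 * c.R) dft).absHi : ℝ) / c.S
  set k2 : ℝ := ((t.kpow.getD (2 * c.R + 1) dft).absHi : ℝ) / c.S
  have hA : |rt.A| ≤ (t.A.absHi : ℝ) / c.S := abs_le_absUp hS h.memA
  have hB : |rt.B| ≤ (t.B.absHi : ℝ) / c.S := abs_le_absUp hS h.memB
  have hk1 : |rt.κ| ^ (2 * c.R) ≤ k1 := by
    rw [← abs_pow]; exact abs_le_absUp hS (h.kpow _ (by omega))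
  have hk2 : |rt.κ| ^ (2 * c.R + 1) ≤ k2 := by
    rw [← abs_pow]; exact abs_le_absUp hS (h.kpow _ le_rfl)
  set x : ℝ := a' * (k1 * η ^ (2 * c.R) / ((2 * c.R).factorial : ℕ)) +
    a' * (k2 * η ^ (2 * c.R + 1) / ((2 * c.R + 1).factorial : ℕ)) with hx
  have hmem : MI.mem c.S x (c.remTerm etaPow t) := by
    unfold remTerm
    have ha' : MI.mem c.S a' ((absUp t.A).add (absUp t.B)) := MI.mem_add (mem_absUp hS _) (mem_absUp hS _)
    refine MI.mem_add (MI.mem_mul hS ha' ?_) (MI.mem_mul hS ha' ?_)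
    · exact MI.mem_divNat (MI.mem_mul hS (mem_absUp hS _) (hep _ (by omega))) (Nat.factorial_pos _)
    · exact MI.mem_divNat (MI.mem_mul hS (mem_absUp hS _) (hep _ le_rfl)) (Nat.factorial_pos _)
  refine ⟨x, ?_, hmem⟩
  unfold RTerm.rem
  have ha'0 : |rt.A| + |rt.B| ≤ a' := add_le_add hA hB
  have hpos : 0 ≤ |rt.A| + |rt.B| := by positivity
  rw [hx, mul_pow, mul_pow]
  have e1 : |rt.κ| ^ (2 * c.R) * η ^ (2 * c.R) / ((2 * c.R).factorial : ℝ) ≤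
      k1 * η ^ (2 * c.R) / ((2 * c.R).factorial : ℕ) := by
    gcongr
  have e2 : |rt.κ| ^ (2 * c.R + 1) * η ^ (2 * c.R + 1) / ((2 * c.R + 1).factorial : ℝ) ≤
      k2 * η ^ (2 * c.R + 1) / ((2 * c.R + 1).factorial : ℕ) := by
    gcongr
  have hq1 : 0 ≤ k1 * η ^ (2 * c.R) / ((2 * c.R).factorial : ℕ) := by
    have : 0 ≤ k1 := le_trans (by positivity) hk1
    positivity
  have hq2 : 0 ≤ k2 * η ^ (2 * c.R + 1) / ((2 * c.R + 1).factorial : ℕ) := by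
    have : 0 ≤ k2 := le_trans (by positivity) hk2
    positivity
  calc (|rt.A| + |rt.B|) * (|rt.κ| ^ (2 * c.R) * η ^ (2 * c.R) / ((2 * c.R).factorial : ℝ) +
        |rt.κ| ^ (2 * c.R + 1) * η ^ (2 * c.R + 1) / ((2 * c.R + 1).factorial : ℝ))
      ≤ (|rt.A| + |rt.B|) * (k1 * η ^ (2 * c.R) / ((2 * c.R).factorial : ℕ) +
          k2 * η ^ (2 * c.R + 1) / ((2 * c.R + 1).factorial : ℕ)) := by
        exact mul_le_mul_of_nonneg_left (add_le_add e1 e2) hpos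
    _ ≤ a' * (k1 * η ^ (2 * c.R) / ((2 * c.R).factorial : ℕ) +
          k2 * η ^ (2 * c.R + 1) / ((2 * c.R + 1).factorial : ℕ)) :=
        mul_le_mul_of_nonneg_right ha'0 (add_nonneg hq1 hq2)
    _ = _ := by ring

/-- **The block remainder**: `remSum rts η R ≤ remBlock.hi / S`. [folklore] -/
theorem remSum_le_remBlock (hS : 0 < c.S) {η : ℝ} (hη : 0 ≤ η) {etaPow : List MI}
    (hep : ∀ m ≤ 2 * c.R + 1, MI.mem c.S (η ^ m) (etaPow.getD m dft)) :
    ∀ {ts : List GTerm} {rts : List RTerm}, List.Forall₂ (GRepr c.S c.R) ts rts →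
      ∃ x : ℝ, remSum rts η c.R ≤ x ∧ MI.mem c.S x (c.remBlock etaPow ts) := by
  intro ts rts hF
  induction hF with
  | nil => exact ⟨0, by simp, by simpa [remBlock] using MI.mem_ofInt c.S 0⟩
  | @cons t rt ts rts hh hF ih =>
      obtain ⟨x, hx, hmx⟩ := ih
      obtain ⟨y, hy, hmy⟩ := rem_le_remTerm hS hh hη hep
      refine ⟨y + x, ?_, ?_⟩
      · rw [remSum_cons]; exact add_le_add hy hx
      · simp only [remBlock, List.map_cons, List.foldr_cons]
        exact MI.mem_add hmy (by simpa [remBlock] using hmx)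

/-- Corollary: `remSum rts η R ≤ remBlock.hi / S`. [folklore] -/
theorem remSum_le_remBlock_hi (hS : 0 < c.S) {η : ℝ} (hη : 0 ≤ η) {etaPow : List MI}
    (hep : ∀ m ≤ 2 * c.R + 1, MI.mem c.S (η ^ m) (etaPow.getD m dft))
    {ts : List GTerm} {rts : List RTerm} (hF : List.Forall₂ (GRepr c.S c.R) ts rts) :
    remSum rts η c.R ≤ ((c.remBlock etaPow ts).hi : ℝ) / c.S := by
  obtain ⟨x, hx, hmx⟩ := remSum_le_remBlock hS hη hep hF
  exact hx.trans (le_hi hS hmx)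

/-! ### Two small facts for the cell theorem -/


/-- Dropping terms does not increase the (termwise non-negative) remainder. [folklore] -/
theorem remSum_cList_le {η : ℝ} (hη : 0 ≤ η) (R : ℕ) : ∀ (ts : List GTerm) (rts : List RTerm),
    remSum (cList ts rts) η R ≤ remSum rts η R
  | [], [] => by simp [cList]
  | [], _ :: _ => by
      simp only [cList, remSum_nil]
      rw [remSum_cons]
      have := fun t : RTerm ↦ (show 0 ≤ t.rem η R by unfold RTerm.rem; positivity)
      have hrest : ∀ l : List RTerm, 0 ≤ remSum l η R := by
        intro l; induction l with
        | nil => simp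
        | cons t l ih => rw [remSum_cons]; exact add_nonneg (this t) ih
      exact add_nonneg (this _) (hrest _)
  | _ :: _, [] => by simp [cList]
  | t :: ts, rt :: rts => by
      have ih := remSum_cList_le hη R ts rts
      have h0 : 0 ≤ rt.rem η R := by unfold RTerm.rem; positivity
      by_cases h : t.comm = true
      · simp only [cList, h, if_true, remSum_cons]; linarith
      · simp only [cList, h, Bool.false_eq_true, if_false, remSum_cons]; linarith

/-- Powers of `η⁺`. [folklore] -/
theorem etaPow_mem (hS : 0 < c.S) {b : DKBlock} (hden : 1 ≤ b.etaDen) :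
    ∀ m ≤ 2 * c.R + 1, MI.mem c.S (((b.etaNum : ℝ) / b.etaDen) ^ m) ((c.etaPow b).getD m dft) := by
  have hη : MI.mem c.S ((b.etaNum : ℝ) / b.etaDen) (MI.ofFrac c.S b.etaNum b.etaDen) := by
    have := MI.mem_ofFrac c.S (b.etaNum : ℤ) (q := b.etaDen) (by omega)
    convert this using 2; norm_cast
  exact (powList_spec hS hη (2 * c.R + 1)).2

end DKCert

end Summit.Ventures.WeilGRH

end
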